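import Literature.Barriers.CriticalPhenomena.PlaquetteWalkHoleRootNoKiss
import HarnessLib

/-!
# Barrier catalogue (SAWScalingLimit): straight cells and straight runs of a Yang–Baxter plaquette walk

`Z → ∞` limit model of the printed Yang–Baxter weights [GlazmanManolescu2019, §1, eq. (1)]; the «RECTANGLE COEFFICIENT» line of the venture lane «pcv-sawmu»
(b-engine-1 g26). Service lemmas of the CHAIN CALCULUS (`PlaquetteWalkKissChains`): a plaquette whose arcs use two opposite sides and miss a third side carries
only straight arcs (`YBWalk.straight_of_usesSide_NS/EW`), and an arc leaving through `S`/`N`/`E`/`W` into a column/row of such plaquettes is followed by the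
straight run through them (`YBWalk.run_down/up/east/west_of_straight`, and the runs read backwards `run_back_below/above_of_straight`). Used by
`PlaquetteWalkHoleRootNotTopRow` («B2a MEMBERS LIVE ON THE ROOT ROW»). [GlazmanManolescu2019 §1 Fig. 1 (consecutive arcs lie in adjacent rhombi; the
configurations `u₁, u₂, v`)]
-/

noncomputable section

namespace Literature.Probability.RandomPlanarGeometry.SAW.YangBaxter

open Real
open Literature.Barriers.CriticalPhenomena.PlaquetteWalk

namespace YBWalk

variable {D : Set Face} {a z : MidEdge} (γ : YBWalk D a z)

/-! ## Straight cells and straight runs through them -/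

/-- **A plaquette using both `N` and `S` but with an unused side carries only STRAIGHT (vertical) arcs.** [cite: GlazmanManolescu2019, §1, Fig. 1 (the configuration `v`)] -/
theorem straight_of_usesSide_NS {c : Face} {s : Side} (hN : γ.UsesSide c .N) (hS : γ.UsesSide c .S) (hs : ¬γ.UsesSide c s) :
    ∀ i < γ.arcs.length, γ.fc i = c → arcKind (γ.sIn i) (γ.sOut i) = .straight := by
  intro i hi hci
  obtain ⟨j, hj, hcj, hjN⟩ := hN
  obtain ⟨k, hk, hck, hkS⟩ := hS
  rw [γ.single_visit_of_not_usesSide hs hj hi hcj hci] at hjN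
  rw [γ.single_visit_of_not_usesSide hs hk hi hck hci] at hkS
  have hne := γ.sIn_ne_sOut hi
  revert hjN hkS hne
  cases γ.sIn i <;> cases γ.sOut i <;> decide

/-- **… and one using both `E` and `W` with an unused side carries only STRAIGHT (horizontal) arcs.** [cite: GlazmanManolescu2019, §1, Fig. 1 (the configuration `v`)] -/
theorem straight_of_usesSide_EW {c : Face} {s : Side} (hE : γ.UsesSide c .E) (hW : γ.UsesSide c .W) (hs : ¬γ.UsesSide c s) :
    ∀ i < γ.arcs.length, γ.fc i = c → arcKind (γ.sIn i) (γ.sOut i) = .straight := by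
  intro i hi hci
  obtain ⟨j, hj, hcj, hjE⟩ := hE
  obtain ⟨k, hk, hck, hkW⟩ := hW
  rw [γ.single_visit_of_not_usesSide hs hj hi hcj hci] at hjE
  rw [γ.single_visit_of_not_usesSide hs hk hi hck hci] at hkW
  have hne := γ.sIn_ne_sOut hi
  revert hjE hkW hne
  cases γ.sIn i <;> cases γ.sOut i <;> decide

/-- ★ **A RUN DOWN A COLUMN OF STRAIGHT CELLS**: if the arc `j` leaves through `S` and the `M` plaquettes below carry only straight arcs, the arcs `j + 1, …, j + M`
lie in them in order, each leaving through `S`. [cite: GlazmanManolescu2019, §1, Fig. 1 (consecutive arcs lie in adjacent rhombi)] -/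
theorem run_down_of_straight {j M : ℕ} (hjM : j + M < γ.arcs.length) (hS : γ.sOut j = .S)
    (hcells : ∀ m : ℕ, 1 ≤ m → m ≤ M → ∀ i < γ.arcs.length, γ.fc i = ((γ.fc j).1, (γ.fc j).2 - m) → arcKind (γ.sIn i) (γ.sOut i) = .straight) :
    ∀ m : ℕ, m ≤ M → γ.fc (j + m) = ((γ.fc j).1, (γ.fc j).2 - m) ∧ γ.sOut (j + m) = .S := by
  intro m
  induction m with
  | zero => intro _; exact ⟨by simp, hS⟩
  | succ m ih =>
    intro hm
    obtain ⟨hfc, hout⟩ := ih (by omega)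
    have hlt : j + m + 1 < γ.arcs.length := by omega
    have hfc' := γ.fc_succ_eq_of_sOut_S hlt hout
    have hpos : γ.fc (j + m + 1) = ((γ.fc j).1, (γ.fc j).2 - ((m + 1 : ℕ) : ℤ)) := by
      rw [hfc', hfc]; simp only; push_cast; ring_nf
    refine ⟨hpos, ?_⟩
    have hk := hcells (m + 1) (by omega) hm _ hlt hpos
    -- the entry side after an `S`-exit is `N`
    have hin : γ.sIn (j + m + 1) = .N := by
      obtain ⟨-, ho⟩ := γ.side_sIn_eq_nth (show j + m < γ.arcs.length by omega)
      obtain ⟨hi, -⟩ := γ.side_sIn_eq_nth hlt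
      have e1 : (γ.fc (j + m + 1)).side (γ.sIn (j + m + 1)) = (γ.fc (j + m)).side .S := by rw [hi, ← ho, hout]
      rw [hfc'] at e1
      have e2 : Face.side (((γ.fc (j + m)).1, (γ.fc (j + m)).2 - 1) : Face) .N = (γ.fc (j + m)).side .S := by
        obtain ⟨x, y⟩ := γ.fc (j + m); simp [Face.side]
      exact Face.side_injective _ (e1.trans e2.symm)
    show γ.sOut (j + m + 1) = .S
    rw [γ.sOut_of_straight hlt hk, hin]; rfl

/-- ★ **A RUN UP A COLUMN OF STRAIGHT CELLS** (mirror). [cite: GlazmanManolescu2019, §1, Fig. 1 (consecutive arcs lie in adjacent rhombi)] -/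
theorem run_up_of_straight {j M : ℕ} (hjM : j + M < γ.arcs.length) (hN : γ.sOut j = .N)
    (hcells : ∀ m : ℕ, 1 ≤ m → m ≤ M → ∀ i < γ.arcs.length, γ.fc i = ((γ.fc j).1, (γ.fc j).2 + m) → arcKind (γ.sIn i) (γ.sOut i) = .straight) :
    ∀ m : ℕ, m ≤ M → γ.fc (j + m) = ((γ.fc j).1, (γ.fc j).2 + m) ∧ γ.sOut (j + m) = .N := by
  intro m
  induction m with
  | zero => intro _; exact ⟨by simp, hN⟩
  | succ m ih =>
    intro hm
    obtain ⟨hfc, hout⟩ := ih (by omega)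
    have hlt : j + m + 1 < γ.arcs.length := by omega
    have hfc' := γ.fc_succ_eq_of_sOut_N hlt hout
    have hpos : γ.fc (j + m + 1) = ((γ.fc j).1, (γ.fc j).2 + ((m + 1 : ℕ) : ℤ)) := by
      rw [hfc', hfc]; simp only; push_cast; ring_nf
    refine ⟨hpos, ?_⟩
    have hk := hcells (m + 1) (by omega) hm _ hlt hpos
    have hin : γ.sIn (j + m + 1) = .S := by
      obtain ⟨-, ho⟩ := γ.side_sIn_eq_nth (show j + m < γ.arcs.length by omega)
      obtain ⟨hi, -⟩ := γ.side_sIn_eq_nth hlt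
      have e1 : (γ.fc (j + m + 1)).side (γ.sIn (j + m + 1)) = (γ.fc (j + m)).side .N := by rw [hi, ← ho, hout]
      rw [hfc'] at e1
      have e2 : Face.side (((γ.fc (j + m)).1, (γ.fc (j + m)).2 + 1) : Face) .S = (γ.fc (j + m)).side .N := by
        obtain ⟨x, y⟩ := γ.fc (j + m); simp [Face.side]
      exact Face.side_injective _ (e1.trans e2.symm)
    show γ.sOut (j + m + 1) = .N
    rw [γ.sOut_of_straight hlt hk, hin]; rfl

/-- ★ **A RUN EAST ALONG A ROW OF STRAIGHT CELLS.** [cite: GlazmanManolescu2019, §1, Fig. 1 (consecutive arcs lie in adjacent rhombi)] -/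
theorem run_east_of_straight {j M : ℕ} (hjM : j + M < γ.arcs.length) (hE : γ.sOut j = .E)
    (hcells : ∀ m : ℕ, 1 ≤ m → m ≤ M → ∀ i < γ.arcs.length, γ.fc i = ((γ.fc j).1 + m, (γ.fc j).2) → arcKind (γ.sIn i) (γ.sOut i) = .straight) :
    ∀ m : ℕ, m ≤ M → γ.fc (j + m) = ((γ.fc j).1 + m, (γ.fc j).2) ∧ γ.sOut (j + m) = .E := by
  intro m
  induction m with
  | zero => intro _; exact ⟨by simp, hE⟩
  | succ m ih =>
    intro hm
    obtain ⟨hfc, hout⟩ := ih (by omega)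
    have hlt : j + m + 1 < γ.arcs.length := by omega
    obtain ⟨hfc', hin⟩ := γ.fc_succ_eq_of_sOut_E hlt hout
    have hpos : γ.fc (j + m + 1) = ((γ.fc j).1 + ((m + 1 : ℕ) : ℤ), (γ.fc j).2) := by
      rw [hfc', hfc]; simp only; push_cast; ring_nf
    refine ⟨hpos, ?_⟩
    have hk := hcells (m + 1) (by omega) hm _ hlt hpos
    show γ.sOut (j + m + 1) = .E
    rw [γ.sOut_of_straight hlt hk, hin]; rfl

/-- ★ **A RUN WEST ALONG A ROW OF STRAIGHT CELLS.** [cite: GlazmanManolescu2019, §1, Fig. 1 (consecutive arcs lie in adjacent rhombi)] -/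
theorem run_west_of_straight {j M : ℕ} (hjM : j + M < γ.arcs.length) (hW : γ.sOut j = .W)
    (hcells : ∀ m : ℕ, 1 ≤ m → m ≤ M → ∀ i < γ.arcs.length, γ.fc i = ((γ.fc j).1 - m, (γ.fc j).2) → arcKind (γ.sIn i) (γ.sOut i) = .straight) :
    ∀ m : ℕ, m ≤ M → γ.fc (j + m) = ((γ.fc j).1 - m, (γ.fc j).2) ∧ γ.sOut (j + m) = .W := by
  intro m
  induction m with
  | zero => intro _; exact ⟨by simp, hW⟩
  | succ m ih =>
    intro hm
    obtain ⟨hfc, hout⟩ := ih (by omega)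
    have hlt : j + m + 1 < γ.arcs.length := by omega
    obtain ⟨hfc', hin⟩ := γ.fc_succ_eq_of_sOut_W hlt hout
    have hpos : γ.fc (j + m + 1) = ((γ.fc j).1 - ((m + 1 : ℕ) : ℤ), (γ.fc j).2) := by
      rw [hfc', hfc]; simp only; push_cast; ring_nf
    refine ⟨hpos, ?_⟩
    have hk := hcells (m + 1) (by omega) hm _ hlt hpos
    show γ.sOut (j + m + 1) = .W
    rw [γ.sOut_of_straight hlt hk, hin]; rfl


/-- The exit side of the arc before an arc entering through `S` is `N` (restated with the plaquette). [cite: GlazmanManolescu2019, §1, Fig. 1] -/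
private theorem fc_sOut_pred_of_sIn_S {i : ℕ} (hi : i < γ.arcs.length) (h1 : 1 ≤ i) (hS : γ.sIn i = .S) :
    γ.fc (i - 1) = ((γ.fc i).1, (γ.fc i).2 - 1) ∧ γ.sOut (i - 1) = .N := by
  have hp := γ.fc_pred_eq_of_sIn_S hi h1 hS
  refine ⟨hp, ?_⟩
  obtain ⟨hin, -⟩ := γ.side_sIn_eq_nth hi
  obtain ⟨-, hout⟩ := γ.side_sIn_eq_nth (show i - 1 < γ.arcs.length by omega)
  rw [show i - 1 + 1 = i by omega, ← hin, hp, hS] at hout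
  have e : Face.side (((γ.fc i).1, (γ.fc i).2 - 1) : Face) .N = (γ.fc i).side .S := by
    obtain ⟨x, y⟩ := γ.fc i; simp [Face.side]
  exact Face.side_injective _ (hout.trans e.symm)

/-- The exit side of the arc before an arc entering through `N` is `S`. [cite: GlazmanManolescu2019, §1, Fig. 1] -/
private theorem fc_sOut_pred_of_sIn_N {i : ℕ} (hi : i < γ.arcs.length) (h1 : 1 ≤ i) (hN : γ.sIn i = .N) :
    γ.fc (i - 1) = ((γ.fc i).1, (γ.fc i).2 + 1) ∧ γ.sOut (i - 1) = .S := by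
  have hp := γ.fc_pred_eq_of_sIn_N hi h1 hN
  refine ⟨hp, ?_⟩
  obtain ⟨hin, -⟩ := γ.side_sIn_eq_nth hi
  obtain ⟨-, hout⟩ := γ.side_sIn_eq_nth (show i - 1 < γ.arcs.length by omega)
  rw [show i - 1 + 1 = i by omega, ← hin, hp, hN] at hout
  have e : Face.side (((γ.fc i).1, (γ.fc i).2 + 1) : Face) .S = (γ.fc i).side .N := by
    obtain ⟨x, y⟩ := γ.fc i; simp [Face.side]
  exact Face.side_injective _ (hout.trans e.symm)

/-- ★ **A RUN READ BACKWARDS, DOWN A COLUMN OF STRAIGHT CELLS**: if the arc `j` enters through `S` and the `M ≤ j` plaquettes below carry only straight arcs, the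
arcs `j − 1, …, j − M` lie in them in order, each entering through `S`. [cite: GlazmanManolescu2019, §1, Fig. 1 (consecutive arcs lie in adjacent rhombi)] -/
theorem run_back_below_of_straight {j M : ℕ} (hj : j < γ.arcs.length) (hMj : M ≤ j) (hS : γ.sIn j = .S)
    (hcells : ∀ m : ℕ, 1 ≤ m → m ≤ M → ∀ i < γ.arcs.length, γ.fc i = ((γ.fc j).1, (γ.fc j).2 - m) → arcKind (γ.sIn i) (γ.sOut i) = .straight) :
    ∀ m : ℕ, m ≤ M → γ.fc (j - m) = ((γ.fc j).1, (γ.fc j).2 - m) ∧ γ.sIn (j - m) = .S := by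
  intro m
  induction m with
  | zero => intro _; exact ⟨by simp, hS⟩
  | succ m ih =>
    intro hm
    obtain ⟨hfc, hin⟩ := ih (by omega)
    obtain ⟨hfc', hout⟩ := γ.fc_sOut_pred_of_sIn_S (i := j - m) (by omega) (by omega) hin
    rw [show j - m - 1 = j - (m + 1) by omega] at hfc' hout
    have hpos : γ.fc (j - (m + 1)) = ((γ.fc j).1, (γ.fc j).2 - ((m + 1 : ℕ) : ℤ)) := by
      rw [hfc', hfc]; simp only; push_cast; ring_nf
    refine ⟨hpos, ?_⟩
    have hk := hcells (m + 1) (by omega) hm _ (by omega) hpos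
    have h2 := γ.sOut_of_straight (show j - (m + 1) < γ.arcs.length by omega) hk
    rw [hout] at h2
    revert h2; cases γ.sIn (j - (m + 1)) <;> decide

/-- ★ **A RUN READ BACKWARDS, UP A COLUMN OF STRAIGHT CELLS** (mirror). [cite: GlazmanManolescu2019, §1, Fig. 1 (consecutive arcs lie in adjacent rhombi)] -/
theorem run_back_above_of_straight {j M : ℕ} (hj : j < γ.arcs.length) (hMj : M ≤ j) (hN : γ.sIn j = .N)
    (hcells : ∀ m : ℕ, 1 ≤ m → m ≤ M → ∀ i < γ.arcs.length, γ.fc i = ((γ.fc j).1, (γ.fc j).2 + m) → arcKind (γ.sIn i) (γ.sOut i) = .straight) :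
    ∀ m : ℕ, m ≤ M → γ.fc (j - m) = ((γ.fc j).1, (γ.fc j).2 + m) ∧ γ.sIn (j - m) = .N := by
  intro m
  induction m with
  | zero => intro _; exact ⟨by simp, hN⟩
  | succ m ih =>
    intro hm
    obtain ⟨hfc, hin⟩ := ih (by omega)
    obtain ⟨hfc', hout⟩ := γ.fc_sOut_pred_of_sIn_N (i := j - m) (by omega) (by omega) hin
    rw [show j - m - 1 = j - (m + 1) by omega] at hfc' hout
    have hpos : γ.fc (j - (m + 1)) = ((γ.fc j).1, (γ.fc j).2 + ((m + 1 : ℕ) : ℤ)) := by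
      rw [hfc', hfc]; simp only; push_cast; ring_nf
    refine ⟨hpos, ?_⟩
    have hk := hcells (m + 1) (by omega) hm _ (by omega) hpos
    have h2 := γ.sOut_of_straight (show j - (m + 1) < γ.arcs.length by omega) hk
    rw [hout] at h2
    revert h2; cases γ.sIn (j - (m + 1)) <;> decide

end YBWalk

end Literature.Probability.RandomPlanarGeometry.SAW.YangBaxter
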